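import Mathlib
import HarnessLib
import Summits.HubbardSuperconductivity.HubbardSuperconductivity.Theorems.KLProgrammeKLRegimeTwoVolumeInductiveStep

/-!
# Route `KLProgramme` — crux K3, the nested two-volume pass: the STEP's right-hand side as a LINEAR form in the vanishing quantities
# (cell gate-hubbard-kl, seat hubbard-kl-k3c4-p1 g9; memo VL-ROUTE-A-RADIUS-g9.md §3; `--supports` stmt-…-20440)

The bound of `…TwoVolumeInductiveStep.sum_norm_kernel_twoVolume_step_le` is a closed expression in the scale constants (`n, ρ′, κ′, αw, ρ₂, κ₂, ρf, κf, α, α′,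
m₁, m₁′, s, s′`, the one-volume input norms `νVD, νV, νD, ν₂, νf`) and in FIVE quantities that vanish along the volume in the rate-free induction of the VL stub:
the input norm `νE = normV Γ′ κ′ ρ′ E` of the incoming defect (Tannery, `…TwoVolumeDefectTannery`), the near-defect entry bound `Te`, the far-tail bound `T`,
`Rf⁻¹` (depth of the pin below the covariance zone) and `(φ(Rd))⁻¹` (zone weight at the pin's depth below the defect region).  This file rewrites that expression,
with the `normV`-subterms abstracted to real variables (instantiate them verbatim), as

  `≤ K_E·νE + K_D·(φ(Rd))⁻¹ + K_Te·Te + K_T·T + K_Rf·Rf⁻¹`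

with coefficients that are closed terms in the scale constants (`twoVolume_step_rhs_le_linear`; an identity in the last four, one monotonicity in the first under a
cap `νE ≤ ν̄E`), records the trivial limit algebra the induction then uses (`tendsto_linear₅_zero`, `tendsto_transfer_rhs_zero`), and restates the STEP
itself in this linear form (**`sum_norm_kernel_twoVolume_step_le_linear`**, §4: the defect's smallness line `hθ₁` replaced by the cap).

Pure real arithmetic; no definition.  Reference for the role: BGM 2006 §3 (per-scale organisation of the bounds).
-/

noncomputable section

namespace Summit.HubbardSuperconductivity.HubbardSuperconductivity.Theorems.TwoVolumeDefect

set_option linter.dupNamespace false -- summit = problem name (single-conjunct summit), D-0017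

open Finset Filter Topology

/-! ## §1 Monotonicity of the interaction bracket's first term in the defect norm -/

/-- `x ↦ e·x/(1 − c·(v + x))²` is bounded by `e·x/(1 − c·(v + x̄))²` for `0 ≤ x ≤ x̄`, `0 ≤ c`, `c·(v + x̄) < 1`. [folklore] -/
theorem mul_div_one_sub_sq_le {x xbar c v : ℝ} (hx0 : 0 ≤ x) (hx : x ≤ xbar) (hc : 0 ≤ c) (hbar : c * (v + xbar) < 1) :
    Real.exp 1 * x / (1 - c * (v + x)) ^ 2 ≤ Real.exp 1 * x / (1 - c * (v + xbar)) ^ 2 := by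
  have h1 : 0 < 1 - c * (v + xbar) := sub_pos.2 hbar
  have h2 : 1 - c * (v + xbar) ≤ 1 - c * (v + x) := by nlinarith
  have h3 : 0 < 1 - c * (v + x) := h1.trans_le h2
  have hnum : 0 ≤ Real.exp 1 * x := mul_nonneg (Real.exp_pos 1).le hx0
  exact div_le_div_of_nonneg_left hnum (pow_pos h1 2) (pow_le_pow_left₀ h1.le h2 2)

/-! ## §2 The right-hand side of the STEP is a linear form in `(νE, (φ Rd)⁻¹, Te, T, Rf⁻¹)` -/

/-- **THE STEP'S BOUND AS A LINEAR FORM.**  With the `normV`-subterms of `sum_norm_kernel_twoVolume_step_le` abstracted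
(`νE := normV Γ′ κ′ ρ′ E`, `νVD := normV Γ′ κ′ ρ′ (NV + ND)`, `νV := normV Γ′ κ′ ρ′ NV`, `νD := normV Γ′ κ′ ρ′ ND`, `ν₂ := normV Γ′ κ₂ ρ₂ Nw`,
`νf := normV Γ′ κf ρf Nw`, `c2 := ‖(2:𝕜)⁻¹‖`, `φR := φ(Rd)`) and a cap `0 ≤ νE ≤ ν̄E` with `e·αw·(νVD + ν̄E)/κ′² < 1` (`0 ≤ αw`, `0 ≤ ρ′`), the right-hand side is
`≤ K_E νE + K_D φR⁻¹ + K_Te Te + K_T T + K_Rf Rf⁻¹` with the displayed closed coefficients. [folklore] -/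
theorem twoVolume_step_rhs_le_linear (n : ℕ) {νE νEbar νVD νV νD ν₂ νf c2 φR Te T Rf s s' α α' m₁ m₁' αw κ' κ₂ κf ρ' ρ₂ ρf : ℝ}
    (hρ' : 0 ≤ ρ') (hνE0 : 0 ≤ νE) (hνE : νE ≤ νEbar) (hαw : 0 ≤ αw)
    (hbar : Real.exp 1 * αw * (νVD + νEbar) / κ' ^ 2 < 1) :
    (ρ'⁻¹ ^ (n + 1) * (Real.exp 1 * νE) / (1 - Real.exp 1 * αw * (νVD + νE) / κ' ^ 2) ^ 2 +
          φR⁻¹ * (ρ'⁻¹ ^ (n + 1) * (Real.exp 1 * νD) / (1 - Real.exp 1 * αw * (νV + νD) / κ' ^ 2) ^ 2)) +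
      (
        ((((n + 1 + 1) * (n + 1 + 2) : ℕ) : ℝ) / 2 * Te * (ρ₂⁻¹ ^ (n + 3) * (Real.exp 1 * ν₂) / (1 - Real.exp 1 * (α' + α + (m₁' + m₁)) * ν₂ / κ₂ ^ 2)) +
            c2 * ∑ a ∈ range (n + 2), ∑ b ∈ range (n + 2),
              (if a + b = n + 1 then (((a + 1) * (b + 1) : ℕ) : ℝ) *
                (2 * T * (ρ₂⁻¹ ^ (a + 1) * (Real.exp 1 * ν₂) / (1 - Real.exp 1 * (α' + α + (m₁' + m₁)) * ν₂ / κ₂ ^ 2)) *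
                    (ρ₂⁻¹ ^ (b + 1) * (Real.exp 1 * ν₂) / (1 - Real.exp 1 * (α' + α + (m₁' + m₁)) * ν₂ / κ₂ ^ 2)) +
                  2 * T * (ρ₂⁻¹ ^ (a + 1) * (Real.exp 1 * ν₂) / (1 - Real.exp 1 * (α' + α + (m₁' + m₁)) * ν₂ / κ₂ ^ 2)) *
                    (ρ₂⁻¹ ^ (b + 1) * (Real.exp 1 * ν₂) / (1 - Real.exp 1 * (α' + α + (m₁' + m₁)) * ν₂ / κ₂ ^ 2))) else 0)) +
          ((((n + 1 + 1) * (n + 1 + 2) : ℕ) : ℝ) / 2 * ((s' + s) / Rf) *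
              (ρf⁻¹ ^ (n + 3) * (Real.exp 1 * νf) /
                (1 - Real.exp 1 * (α' + α + (m₁' + m₁)) * νf / κf ^ 2)) +
            c2 * ∑ a ∈ range (n + 2), ∑ b ∈ range (n + 2),
              (if a + b = n + 1 then (((a + 1) * (b + 1) : ℕ) : ℝ) *
                ((α' + α) *
                    (ρf⁻¹ ^ (a + 1) * (Real.exp 1 * νf) /
                        (1 - Real.exp 1 * (α' + α + (m₁' + m₁)) * νf / κf ^ 2) / Rf) *
                    (ρf⁻¹ ^ (b + 1) * (Real.exp 1 * νf) /
                      (1 - Real.exp 1 * (α' + α + (m₁' + m₁)) * νf / κf ^ 2)) +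
                  (α' + α) *
                    (ρf⁻¹ ^ (a + 1) * (Real.exp 1 * νf) /
                      (1 - Real.exp 1 * (α' + α + (m₁' + m₁)) * νf / κf ^ 2)) *
                    (ρf⁻¹ ^ (b + 1) * (Real.exp 1 * νf) /
                        (1 - Real.exp 1 * (α' + α + (m₁' + m₁)) * νf / κf ^ 2) / Rf)) else 0))
      ) ≤
      (ρ'⁻¹ ^ (n + 1) * Real.exp 1 / (1 - Real.exp 1 * αw * (νVD + νEbar) / κ' ^ 2) ^ 2) * νE +
        (ρ'⁻¹ ^ (n + 1) * (Real.exp 1 * νD) / (1 - Real.exp 1 * αw * (νV + νD) / κ' ^ 2) ^ 2) * φR⁻¹ +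
        ((((n + 1 + 1) * (n + 1 + 2) : ℕ) : ℝ) / 2 *
            (ρ₂⁻¹ ^ (n + 3) * (Real.exp 1 * ν₂) / (1 - Real.exp 1 * (α' + α + (m₁' + m₁)) * ν₂ / κ₂ ^ 2))) * Te +
        (c2 * ∑ a ∈ range (n + 2), ∑ b ∈ range (n + 2),
            (if a + b = n + 1 then (((a + 1) * (b + 1) : ℕ) : ℝ) *
              (4 * (ρ₂⁻¹ ^ (a + 1) * (Real.exp 1 * ν₂) / (1 - Real.exp 1 * (α' + α + (m₁' + m₁)) * ν₂ / κ₂ ^ 2)) *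
                (ρ₂⁻¹ ^ (b + 1) * (Real.exp 1 * ν₂) / (1 - Real.exp 1 * (α' + α + (m₁' + m₁)) * ν₂ / κ₂ ^ 2))) else 0)) * T +
        ((((n + 1 + 1) * (n + 1 + 2) : ℕ) : ℝ) / 2 * (s' + s) *
              (ρf⁻¹ ^ (n + 3) * (Real.exp 1 * νf) / (1 - Real.exp 1 * (α' + α + (m₁' + m₁)) * νf / κf ^ 2)) +
            c2 * ∑ a ∈ range (n + 2), ∑ b ∈ range (n + 2),
              (if a + b = n + 1 then (((a + 1) * (b + 1) : ℕ) : ℝ) *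
                (2 * (α' + α) * (ρf⁻¹ ^ (a + 1) * (Real.exp 1 * νf) / (1 - Real.exp 1 * (α' + α + (m₁' + m₁)) * νf / κf ^ 2)) *
                  (ρf⁻¹ ^ (b + 1) * (Real.exp 1 * νf) / (1 - Real.exp 1 * (α' + α + (m₁' + m₁)) * νf / κf ^ 2))) else 0)) * Rf⁻¹ := by
  -- abbreviations
  set X₂ : ℕ → ℝ := fun k => ρ₂⁻¹ ^ k * (Real.exp 1 * ν₂) / (1 - Real.exp 1 * (α' + α + (m₁' + m₁)) * ν₂ / κ₂ ^ 2) with hX₂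
  set Xf : ℕ → ℝ := fun k => ρf⁻¹ ^ k * (Real.exp 1 * νf) / (1 - Real.exp 1 * (α' + α + (m₁' + m₁)) * νf / κf ^ 2) with hXf
  set cn : ℝ := ((((n + 1 + 1) * (n + 1 + 2) : ℕ) : ℝ)) with hcn
  -- the first term: monotone in `νE`
  have h1 : ρ'⁻¹ ^ (n + 1) * (Real.exp 1 * νE) / (1 - Real.exp 1 * αw * (νVD + νE) / κ' ^ 2) ^ 2 ≤
      (ρ'⁻¹ ^ (n + 1) * Real.exp 1 / (1 - Real.exp 1 * αw * (νVD + νEbar) / κ' ^ 2) ^ 2) * νE := by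
    have hc : 0 ≤ Real.exp 1 * αw / κ' ^ 2 := by positivity
    have hbar' : Real.exp 1 * αw / κ' ^ 2 * (νVD + νEbar) < 1 := by rw [div_mul_eq_mul_div]; exact hbar
    have hm := mul_div_one_sub_sq_le hνE0 hνE hc hbar'
    have hρ : 0 ≤ ρ'⁻¹ ^ (n + 1) := pow_nonneg (inv_nonneg.2 hρ') _
    calc ρ'⁻¹ ^ (n + 1) * (Real.exp 1 * νE) / (1 - Real.exp 1 * αw * (νVD + νE) / κ' ^ 2) ^ 2
        = ρ'⁻¹ ^ (n + 1) * (Real.exp 1 * νE / (1 - Real.exp 1 * αw / κ' ^ 2 * (νVD + νE)) ^ 2) := by ring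
      _ ≤ ρ'⁻¹ ^ (n + 1) * (Real.exp 1 * νE / (1 - Real.exp 1 * αw / κ' ^ 2 * (νVD + νEbar)) ^ 2) := mul_le_mul_of_nonneg_left hm hρ
      _ = (ρ'⁻¹ ^ (n + 1) * Real.exp 1 / (1 - Real.exp 1 * αw * (νVD + νEbar) / κ' ^ 2) ^ 2) * νE := by ring
  -- the `T`-sum: factor `T`
  have h2 : ∑ a ∈ range (n + 2), ∑ b ∈ range (n + 2),
        (if a + b = n + 1 then (((a + 1) * (b + 1) : ℕ) : ℝ) * (2 * T * X₂ (a + 1) * X₂ (b + 1) + 2 * T * X₂ (a + 1) * X₂ (b + 1)) else 0) =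
      (∑ a ∈ range (n + 2), ∑ b ∈ range (n + 2),
        (if a + b = n + 1 then (((a + 1) * (b + 1) : ℕ) : ℝ) * (4 * X₂ (a + 1) * X₂ (b + 1)) else 0)) * T := by
    rw [sum_mul]
    refine sum_congr rfl fun a _ => ?_
    rw [sum_mul]
    refine sum_congr rfl fun b _ => ?_
    split_ifs <;> ring
  -- the `Rf`-sum: factor `Rf⁻¹`
  have h3 : ∑ a ∈ range (n + 2), ∑ b ∈ range (n + 2),
        (if a + b = n + 1 then (((a + 1) * (b + 1) : ℕ) : ℝ) *
          ((α' + α) * (Xf (a + 1) / Rf) * Xf (b + 1) + (α' + α) * Xf (a + 1) * (Xf (b + 1) / Rf)) else 0) =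
      (∑ a ∈ range (n + 2), ∑ b ∈ range (n + 2),
        (if a + b = n + 1 then (((a + 1) * (b + 1) : ℕ) : ℝ) * (2 * (α' + α) * Xf (a + 1) * Xf (b + 1)) else 0)) * Rf⁻¹ := by
    rw [sum_mul]
    refine sum_congr rfl fun a _ => ?_
    rw [sum_mul]
    refine sum_congr rfl fun b _ => ?_
    split_ifs <;> ring
  -- assemble
  have h4 : cn / 2 * Te * X₂ (n + 3) = (cn / 2 * X₂ (n + 3)) * Te := by ring
  have h5 : cn / 2 * ((s' + s) / Rf) * Xf (n + 3) = (cn / 2 * (s' + s) * Xf (n + 3)) * Rf⁻¹ := by ring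
  have h6 : φR⁻¹ * (ρ'⁻¹ ^ (n + 1) * (Real.exp 1 * νD) / (1 - Real.exp 1 * αw * (νV + νD) / κ' ^ 2) ^ 2) =
      (ρ'⁻¹ ^ (n + 1) * (Real.exp 1 * νD) / (1 - Real.exp 1 * αw * (νV + νD) / κ' ^ 2) ^ 2) * φR⁻¹ := by ring
  simp only [hX₂, hXf, hcn] at h2 h3 h4 h5
  rw [h2, h3, h4, h5, h6]
  linarith [h1]

/-! ## §3 The limit algebra of the induction -/

/-- **A linear form in five vanishing quantities vanishes**: `νE, Te, T → 0` and `φR, Rf → +∞` along a filter ⇒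
`K_E νE + K_D φR⁻¹ + K_Te Te + K_T T + K_Rf Rf⁻¹ → 0`. [folklore] -/
theorem tendsto_linear₅_zero {ι : Type*} {l : Filter ι} (KE KD KTe KT KRf : ℝ) {νE Te T φR Rf : ι → ℝ}
    (hνE : Tendsto νE l (𝓝 0)) (hTe : Tendsto Te l (𝓝 0)) (hT : Tendsto T l (𝓝 0)) (hφ : Tendsto φR l atTop) (hRf : Tendsto Rf l atTop) :
    Tendsto (fun i => KE * νE i + KD * (φR i)⁻¹ + KTe * Te i + KT * T i + KRf * (Rf i)⁻¹) l (𝓝 0) := by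
  have h := (((hνE.const_mul KE).add (hφ.inv_tendsto_atTop.const_mul KD)).add (hTe.const_mul KTe)).add (hT.const_mul KT) |>.add
    (hRf.inv_tendsto_atTop.const_mul KRf)
  simpa using h

/-- **The transfer bound vanishes**: with `E, τ, Nfar → 0` along a filter and fixed `a, N, ND, n`,
`aⁿ(a E + τ ND) + (2 aⁿ τ N + n aⁿ (5 τ N + 2 a Nfar)) → 0` (the right-hand side of `sum_norm_kernel_map_sub_glue_map_le_of_defect`). [folklore] -/
theorem tendsto_transfer_rhs_zero {ι : Type*} {l : Filter ι} (a N ND : ℝ) (n : ℕ) {E τ Nfar : ι → ℝ}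
    (hE : Tendsto E l (𝓝 0)) (hτ : Tendsto τ l (𝓝 0)) (hNfar : Tendsto Nfar l (𝓝 0)) :
    Tendsto (fun i => a ^ n * (a * E i + τ i * ND) + (2 * a ^ n * τ i * N + n * a ^ n * (5 * τ i * N + 2 * a * Nfar i))) l (𝓝 0) := by
  have h1 : Tendsto (fun i => a ^ n * (a * E i + τ i * ND)) l (𝓝 0) := by
    simpa using ((hE.const_mul a).add (hτ.mul_const ND)).const_mul (a ^ n)
  have h2 : Tendsto (fun i => 2 * a ^ n * τ i * N) l (𝓝 0) := by
    simpa [mul_assoc, mul_comm, mul_left_comm] using (hτ.const_mul (2 * a ^ n * N))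
  have h3 : Tendsto (fun i => (n : ℝ) * a ^ n * (5 * τ i * N + 2 * a * Nfar i)) l (𝓝 0) := by
    have := ((hτ.const_mul (5 * N)).add (hNfar.const_mul (2 * a))).const_mul ((n : ℝ) * a ^ n)
    simpa [mul_assoc, mul_comm, mul_left_comm] using this
  simpa using h1.add (h2.add h3)

/-- **Eventually below any threshold**: a real sequence tending to `0` is eventually `≤ δ` and eventually `< δ` for every `δ > 0` (bookkeeping for the
`∃ L₀` extractions of the induction). [folklore] -/
theorem eventually_le_of_tendsto_zero {ι : Type*} {l : Filter ι} {f : ι → ℝ} (hf : Tendsto f l (𝓝 0)) {δ : ℝ} (hδ : 0 < δ) :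
    ∀ᶠ i in l, f i ≤ δ :=
  (hf.eventually (Iio_mem_nhds hδ)).mono fun _ hi => le_of_lt hi

/-! ## §4 The STEP in linear form -/

section Step

open Literature.MathematicalPhysics.QuantumLattice GrassmannAlgebra Literature.Probability.LatticeModels
  Literature.Probability.LatticeModels.BattleFederbush
open scoped Nat InnerProductSpace

variable {𝕜 : Type*} [RCLike 𝕜]

/-- **THE TWO-VOLUME STEP IN LINEAR FORM**: `sum_norm_kernel_twoVolume_step_le` with the defect's smallness line replaced by a cap `normV Γ′ κ′ ρ′ E ≤ ν̄E`,
`e·αw·(normV(NV+ND) + ν̄E)/κ′² < 1`, and the bound rewritten as `K_E·normV E + K_D·(φ Rd)⁻¹ + K_Te·Te + K_T·T + K_Rf·Rf⁻¹` (coefficients closed in the scale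
constants) — the form the rate-free induction consumes (each of the five factors → 0 along the volume). [folklore; BGM 2006 §2–§3; Salmhofer 1999 (2.102)–(2.106)] -/
theorem sum_norm_kernel_twoVolume_step_le_linear {Γ ι : Type*} [Fintype Γ] [DecidableEq Γ] [Fintype ι] [DecidableEq ι]
    {Γ' : Type} [LinearOrder Γ'] [Fintype Γ']
    (e : Γ' ≃ ι × Γ) (C : Matrix Γ Γ 𝕜) (C' Ccop Dn Df : Matrix Γ' Γ' 𝕜) (Zs : Set Γ') [DecidablePred (· ∈ Zs)]
    (hCcop : ∀ X' Y', Ccop X' Y' = if (e X').1 = (e Y').1 then C (e X').2 (e Y').2 else 0)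
    (hDf : ∀ X' Y', Df X' Y' = if X' ∈ Zs ∧ Y' ∈ Zs then C' X' Y' - Ccop X' Y' else 0)
    (hDn : ∀ X' Y', Dn X' Y' = if X' ∈ Zs ∧ Y' ∈ Zs then 0 else C' X' Y' - Ccop X' Y')
    -- (P) periodisation, (G1)/(G2) geometry, row tail
    (hP : ∀ (X' : Γ') (Y : Γ), ∑ Y'' ∈ univ.filter (fun Y'' : Γ' => (e Y'').2 = Y), C' X' Y'' = C (e X').2 Y)
    (Far : Γ' → Γ' → Prop) [∀ X' Y', Decidable (Far X' Y')]
    (hG1 : ∀ X' Y', (e X').1 ≠ (e Y').1 → ¬ (X' ∈ Zs ∧ Y' ∈ Zs) → Far X' Y')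
    (hG2 : ∀ X' Y' Y'', (e X').1 = (e Y').1 → (e Y'').2 = (e Y').2 → Y'' ≠ Y' → ¬ (X' ∈ Zs ∧ Y' ∈ Zs) → Far X' Y'')
    {T : ℝ} (hT0 : 0 < T) (hT : ∀ X', ∑ Y' ∈ univ.filter (fun Y' : Γ' => Far X' Y'), ‖C' X' Y'‖ ≤ T)
    -- the ENTRY bound of the near defect (`norm_near_le_of_fibreTail` / `norm_near_le_of_sectional`)
    {Te : ℝ} (hTe : ∀ X' Y', ‖Dn X' Y'‖ ≤ Te)
    -- antisymmetry and decay numbers of `C`, `C′`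
    (hCt : ∀ X Y, C Y X = -C X Y) (hC't : ∀ X' Y', C' Y' X' = -C' X' Y')
    {s s' : ℝ} (hs0 : 0 ≤ s) (hs'0 : 0 ≤ s') (hs : ∀ X Y, ‖C X Y‖ ≤ s) (hs' : ∀ X' Y', ‖C' X' Y'‖ ≤ s')
    {α α' : ℝ} (hαα : 0 < α' + α) (hrow : ∀ X, ∑ Y, ‖C X Y‖ ≤ α) (hrow' : ∀ X', ∑ Y', ‖C' X' Y'‖ ≤ α')
    (dc : Γ → Γ → ℝ) (hdc : IsLabelDist dc) {m₁ m₁' : ℝ} (hm0 : 0 ≤ m₁) (hm0' : 0 ≤ m₁')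
    (hm1 : ∀ X, ∑ Y, ‖C X Y‖ * dc X Y ≤ m₁) (hm1' : ∀ X', ∑ Y', ‖C' X' Y'‖ * dc (e X').2 (e Y').2 ≤ m₁')
    -- Gram PROPERTIES of the two defects
    {κf : ℝ} (hκf : 0 < κf) (hGBf : ∀ t ∈ Set.Icc (0 : ℝ) 1, IsGramBoundedR (t • Df) κf)
    {κ₂ : ℝ} (hκ₂ : 0 < κ₂) (hGB2 : ∀ t ∈ Set.Icc (0 : ℝ) 1, IsGramBoundedR (Df + t • Dn) κ₂)
    -- the pin, far from the zone in the pulled-back coarse distance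
    {Rf : ℝ} (hRf : 0 < Rf) (w : Γ') (hdR : ∀ X, X ∈ Zs → Rf ≤ dc (e X).2 (e w).2)
    -- the coarse interaction and the block embeddings
    (Fe : ι → (Γ → 𝕜) →ₗ[𝕜] (Γ' → 𝕜)) (hFe : ∀ β v X', Fe β v X' = if (e X').1 = β then v (e X').2 else 0)
    {V : GrassmannAlgebra 𝕜 Γ} (hVe : V ∈ evenOdd 𝕜 0) (hV0 : constPart 𝕜 V = 0) (hZ : IsUnit (effPartitionFn 𝕜 C V))
    -- the coarse diameter-weighted all-degree profile and the two smallness conditions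
    (Nw : ℕ → ℝ) (hNw0 : ∀ m, 0 ≤ Nw m)
    (hNw : ∀ (m' : ℕ) (j : Fin (2 * m')) (x : Γ), ∑ Y ∈ univ.filter (fun Y : Fin (2 * m') → Γ => Y j = x),
      ‖kernel 𝕜 (effAction 𝕜 C V) (2 * m') Y‖ * (1 + labelDiam dc (univ.image Y)) ≤ Nw m')
    {ρf : ℝ} (hρf : 0 < ρf) (hθw : Real.exp 1 * (α' + α + (m₁' + m₁)) * normV Γ' κf ρf Nw / κf ^ 2 < 1)
    {ρ₂ : ℝ} (hρ₂ : 0 < ρ₂) (hθ₂ : Real.exp 1 * (α' + α + (m₁' + m₁)) * normV Γ' κ₂ ρ₂ Nw / κ₂ ^ 2 < 1)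
    -- the INTERACTION bracket: fine covariance Gram/weighted rows, the fine previous action `W′`, its defect against the glued `V`
    {κ' : ℝ} (hκ' : 0 < κ') (hGB' : IsGramBoundedR C' κ')
    (d' : Γ' → Γ' → ℝ) (hd' : IsLabelDist d') {phi : ℝ → ℝ} (hphi1 : ∀ s, 0 ≤ s → 1 ≤ phi s) (hphimono : ∀ s t, 0 ≤ s → s ≤ t → phi s ≤ phi t)
    (hphisub : ∀ s t, 0 ≤ s → 0 ≤ t → phi (s + t) ≤ phi s * phi t)
    (W' : GrassmannAlgebra 𝕜 Γ') (hW'e : W' ∈ evenPart 𝕜 Γ') (hW'0 : constPart 𝕜 W' = 0)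
    (NV ND E : ℕ → ℝ) (hNV0 : ∀ m', 0 ≤ NV m') (hND0 : ∀ m', 0 ≤ ND m') (hE0 : ∀ m', 0 ≤ E m')
    (hNV : ∀ m' (j : Fin (2 * m')) (x : Γ'), ∑ Y ∈ univ.filter (fun Y : Fin (2 * m') → Γ' => Y j = x),
      ‖kernel 𝕜 (∑ β, ExteriorAlgebra.map (Fe β) V) (2 * m') Y‖ * diamWeight phi d' (univ.image Y) ≤ NV m')
    (hND : ∀ m' (j : Fin (2 * m')) (x : Γ'), ∑ Y ∈ univ.filter (fun Y : Fin (2 * m') → Γ' => Y j = x),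
      ‖kernel 𝕜 (W' - ∑ β, ExteriorAlgebra.map (Fe β) V) (2 * m') Y‖ * diamWeight phi d' (univ.image Y) ≤ ND m')
    (Pd : Γ' → Prop) [DecidablePred Pd]
    (hE : ∀ m' (j : Fin (2 * m')) (x : Γ'), Pd x → ∑ Y ∈ univ.filter (fun Y : Fin (2 * m') → Γ' => Y j = x),
      ‖kernel 𝕜 (W' - ∑ β, ExteriorAlgebra.map (Fe β) V) (2 * m') Y‖ ≤ E m')
    {αw : ℝ} (hαw : 0 < αw) (hroww : ∀ X', ∑ Y', ‖C' X' Y'‖ * diamWeight phi d' {X', Y'} ≤ αw)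
    (hcolw : ∀ Y', ∑ X', ‖C' X' Y'‖ * diamWeight phi d' {X', Y'} ≤ αw) {ρ' : ℝ} (hρ' : 0 < ρ')
    {νEbar : ℝ} (hνE : normV Γ' κ' ρ' E ≤ νEbar)
    (hbar : Real.exp 1 * αw * (normV Γ' κ' ρ' (fun m' => NV m' + ND m') + νEbar) / κ' ^ 2 < 1)
    (hθ₂' : Real.exp 1 * αw * (normV Γ' κ' ρ' NV + normV Γ' κ' ρ' ND) / κ' ^ 2 < 1)
    {Rd : ℝ} (hRd : 0 ≤ Rd) (hwd : ∀ z, ¬ Pd z → Rd ≤ d' z w)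
    (n : ℕ) (p : Fin (n + 1)) :
    ∑ X ∈ univ.filter (fun X : Fin (n + 1) → Γ' => X p = w),
        ‖kernel 𝕜 (effAction 𝕜 C' W') (n + 1) X - kernel 𝕜 (∑ β, ExteriorAlgebra.map (Fe β) (effAction 𝕜 C V)) (n + 1) X‖ ≤
            (ρ'⁻¹ ^ (n + 1) * Real.exp 1 / (1 - Real.exp 1 * αw * (normV Γ' κ' ρ' (fun m' => NV m' + ND m') + νEbar) / κ' ^ 2) ^ 2) * normV Γ' κ' ρ' E +
        (ρ'⁻¹ ^ (n + 1) * (Real.exp 1 * normV Γ' κ' ρ' ND) / (1 - Real.exp 1 * αw * (normV Γ' κ' ρ' NV + normV Γ' κ' ρ' ND) / κ' ^ 2) ^ 2) * (phi Rd)⁻¹ +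
        ((((n + 1 + 1) * (n + 1 + 2) : ℕ) : ℝ) / 2 *
            (ρ₂⁻¹ ^ (n + 3) * (Real.exp 1 * normV Γ' κ₂ ρ₂ Nw) / (1 - Real.exp 1 * (α' + α + (m₁' + m₁)) * normV Γ' κ₂ ρ₂ Nw / κ₂ ^ 2))) * Te +
        (‖(2 : 𝕜)⁻¹‖ * ∑ a ∈ range (n + 2), ∑ b ∈ range (n + 2),
            (if a + b = n + 1 then (((a + 1) * (b + 1) : ℕ) : ℝ) *
              (4 * (ρ₂⁻¹ ^ (a + 1) * (Real.exp 1 * normV Γ' κ₂ ρ₂ Nw) / (1 - Real.exp 1 * (α' + α + (m₁' + m₁)) * normV Γ' κ₂ ρ₂ Nw / κ₂ ^ 2)) *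
                (ρ₂⁻¹ ^ (b + 1) * (Real.exp 1 * normV Γ' κ₂ ρ₂ Nw) / (1 - Real.exp 1 * (α' + α + (m₁' + m₁)) * normV Γ' κ₂ ρ₂ Nw / κ₂ ^ 2))) else 0)) * T +
        ((((n + 1 + 1) * (n + 1 + 2) : ℕ) : ℝ) / 2 * (s' + s) *
              (ρf⁻¹ ^ (n + 3) * (Real.exp 1 * normV Γ' κf ρf Nw) / (1 - Real.exp 1 * (α' + α + (m₁' + m₁)) * normV Γ' κf ρf Nw / κf ^ 2)) +
            ‖(2 : 𝕜)⁻¹‖ * ∑ a ∈ range (n + 2), ∑ b ∈ range (n + 2),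
              (if a + b = n + 1 then (((a + 1) * (b + 1) : ℕ) : ℝ) *
                (2 * (α' + α) * (ρf⁻¹ ^ (a + 1) * (Real.exp 1 * normV Γ' κf ρf Nw) / (1 - Real.exp 1 * (α' + α + (m₁' + m₁)) * normV Γ' κf ρf Nw / κf ^ 2)) *
                  (ρf⁻¹ ^ (b + 1) * (Real.exp 1 * normV Γ' κf ρf Nw) / (1 - Real.exp 1 * (α' + α + (m₁' + m₁)) * normV Γ' κf ρf Nw / κf ^ 2))) else 0)) * Rf⁻¹ := by
  have hνE0 : 0 ≤ normV Γ' κ' ρ' E := normV_nonneg hκ'.le hρ'.le hE0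
  have hθ₁ : Real.exp 1 * αw * (normV Γ' κ' ρ' (fun m' => NV m' + ND m') + normV Γ' κ' ρ' E) / κ' ^ 2 < 1 := by
    refine lt_of_le_of_lt ?_ hbar
    have hc : 0 ≤ Real.exp 1 * αw / κ' ^ 2 := by positivity
    have := mul_le_mul_of_nonneg_left (add_le_add_left hνE (normV Γ' κ' ρ' (fun m' => NV m' + ND m'))) hc
    calc Real.exp 1 * αw * (normV Γ' κ' ρ' (fun m' => NV m' + ND m') + normV Γ' κ' ρ' E) / κ' ^ 2
        = Real.exp 1 * αw / κ' ^ 2 * (normV Γ' κ' ρ' E + normV Γ' κ' ρ' (fun m' => NV m' + ND m')) := by ring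
      _ ≤ Real.exp 1 * αw / κ' ^ 2 * (νEbar + normV Γ' κ' ρ' (fun m' => NV m' + ND m')) := this
      _ = _ := by ring
  exact (sum_norm_kernel_twoVolume_step_le e C C' Ccop Dn Df Zs hCcop hDf hDn hP Far hG1 hG2 hT0 hT hTe hCt hC't hs0 hs'0 hs hs' hαα hrow hrow'
    dc hdc hm0 hm0' hm1 hm1' hκf hGBf hκ₂ hGB2 hRf w hdR Fe hFe hVe hV0 hZ Nw hNw0 hNw hρf hθw hρ₂ hθ₂ hκ' hGB' d' hd' hphi1 hphimono hphisub
    W' hW'e hW'0 NV ND E hNV0 hND0 hE0 hNV hND Pd hE hαw hroww hcolw hρ' hθ₁ hθ₂' hRd hwd n p).trans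
    (twoVolume_step_rhs_le_linear n hρ'.le hνE0 hνE hαw.le hbar)

end Step

end Summit.HubbardSuperconductivity.HubbardSuperconductivity.Theorems.TwoVolumeDefect

end
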